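import Mathlib
import Literature.Barriers.MatrixMultiplication.NormalizerBarrier

/-!
# Confinement of disjoint subgroups inside two overgroups
(negative-side lemma for the crux `SubgroupIdentityDesigns`, stmt-MatrixMultiplication-14079; cell B2b-5, gen 9)

Abstract finite-group inequality behind the PACKING NO-GO for block slices
(`run/shared/lean/b2b/levelgraded-cu/b2b-lgcu-borel-g8/BLOCK-SLICES.md`, Lemma 2.3):

* `card_mul_card_inf_le` — if `H₁ ≤ G₁` and `Disjoint H₁ H₂` then `|H₁| · |H₂ ⊓ G₁| ≤ |G₁|`
  (the product map `H₁ × (H₂ ⊓ G₁) → G₁` is injective);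
* `card_inf_mul_relIndex` — `|H ⊓ K| · [H : H ⊓ K] = |H|` (bookkeeping);
* `confinement` — **LEMMA 2.3**: if `H₁ ≤ G₁`, `H₂ ≤ G₂` and `H₁ ⊓ H₂ = ⊥` then
  `|H₁| · |H₂| · |G₁ ⊓ G₂| ≤ |G₁| · |G₂|`, i.e. `|H₁||H₂| ≤ |G₁ G₂|`
  (`[H₂ : H₂ ⊓ G₁] ≤ [G₂ : G₂ ⊓ G₁]`, Mathlib `Subgroup.relIndex_le_of_le_right`);
* `confinement_tpp₁₂/₁₃/₂₃` — the three instances for a subgroup-TPP triple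
  (`Literature.Barriers.MatrixMultiplication.SubgroupTPP` forces pairwise trivial intersections).

Used with `Gᵢ = G(Uᵢ,Kᵢ)`, the type groups of subgroups living in a block slice of `GL_m(𝔽_p)`
(companion files `BlockSliceTypes.lean`, `BlockSlicePacking.lean`).  Sorry-free; standard axioms.
VALUE = a theorem (referee-grade lemma of the block-slice analysis), NOT summit progress; the crux item
stays open.
-/

set_option linter.dupNamespace false

open Literature.Barriers.MatrixMultiplication

namespace Summit.MatrixMultiplication.MatrixMultiplication.Theorems.SubgroupIdentityDesigns.Negative

namespace BlockSliceConfinement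

variable {G : Type*} [Group G]

/-- If `H₁ ≤ G₁` and `H₁ ⊓ H₂ = ⊥` then `(a, b) ↦ a b` injects `H₁ × (H₂ ⊓ G₁)` into `G₁`, so
`|H₁| · |H₂ ⊓ G₁| ≤ |G₁|`. -/
theorem card_mul_card_inf_le [Finite G] {H₁ H₂ G₁ : Subgroup G} (h₁ : H₁ ≤ G₁)
    (hd : Disjoint H₁ H₂) : Nat.card H₁ * Nat.card ↥(H₂ ⊓ G₁) ≤ Nat.card G₁ := by
  classical
  let f : H₁ × ↥(H₂ ⊓ G₁) → G₁ := fun x =>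
    ⟨(x.1 : G) * (x.2 : G), G₁.mul_mem (h₁ x.1.2) (Subgroup.mem_inf.mp x.2.2).2⟩
  have hf : Function.Injective f := by
    rintro ⟨⟨a, ha⟩, ⟨b, hb⟩⟩ ⟨⟨a', ha'⟩, ⟨b', hb'⟩⟩ hab
    have hab' : a * b = a' * b' := congrArg Subtype.val hab
    -- `a'⁻¹ a = b' b⁻¹ ∈ H₁ ⊓ H₂ = ⊥`
    have hx1 : a'⁻¹ * a ∈ H₁ := H₁.mul_mem (H₁.inv_mem ha') ha
    have hx2 : a'⁻¹ * a ∈ H₂ := by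
      have heq : a'⁻¹ * a = b' * b⁻¹ := by
        rw [inv_mul_eq_iff_eq_mul, ← mul_assoc, eq_mul_inv_iff_mul_eq, hab']
      rw [heq]
      exact H₂.mul_mem (Subgroup.mem_inf.mp hb').1 (H₂.inv_mem (Subgroup.mem_inf.mp hb).1)
    have hone : a'⁻¹ * a = 1 := by
      have hmem : a'⁻¹ * a ∈ H₁ ⊓ H₂ := Subgroup.mem_inf.mpr ⟨hx1, hx2⟩
      rw [hd.eq_bot] at hmem
      exact Subgroup.mem_bot.mp hmem
    have haa : a = a' := by
      rw [inv_mul_eq_one] at hone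
      exact hone.symm
    subst haa
    have hbb : b = b' := mul_left_cancel hab'
    subst hbb
    rfl
  have := Nat.card_le_card_of_injective f hf
  rwa [Nat.card_prod] at this

/-- `|H ⊓ K| · [H : H ⊓ K] = |H|`, with the relative index written as `K.relIndex H`. -/
theorem card_inf_mul_relIndex [Finite G] (H K : Subgroup G) :
    Nat.card ↥(H ⊓ K) * K.relIndex H = Nat.card H := by
  have h1 : (H ⊓ K).relIndex H * H.index = (H ⊓ K).index :=
    Subgroup.relIndex_mul_index inf_le_left
  have h2 : (H ⊓ K).relIndex H = K.relIndex H := Subgroup.inf_relIndex_left H K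
  have e1 := (H ⊓ K).card_mul_index
  have e2 := H.card_mul_index
  have hpos : 0 < H.index := Nat.pos_of_ne_zero Subgroup.index_ne_zero_of_finite
  apply Nat.eq_of_mul_eq_mul_right hpos
  calc Nat.card ↥(H ⊓ K) * K.relIndex H * H.index
      = Nat.card ↥(H ⊓ K) * ((H ⊓ K).relIndex H * H.index) := by rw [← h2]; ring
    _ = Nat.card ↥(H ⊓ K) * (H ⊓ K).index := by rw [h1]
    _ = Nat.card G := e1
    _ = Nat.card H * H.index := e2.symm

/-- **CONFINEMENT (BLOCK-SLICES Lemma 2.3).**  If `H₁ ≤ G₁`, `H₂ ≤ G₂` are subgroups of a finite group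
with `H₁ ⊓ H₂ = ⊥`, then `|H₁| · |H₂| · |G₁ ⊓ G₂| ≤ |G₁| · |G₂|` (`= |G₁ G₂| · |G₁ ⊓ G₂|`).
Proof: `|H₁| |H₂ ⊓ G₁| ≤ |G₁|` and `[H₂ : H₂ ⊓ G₁] ≤ [G₂ : G₂ ⊓ G₁]`. -/
theorem confinement [Finite G] {H₁ H₂ G₁ G₂ : Subgroup G} (h₁ : H₁ ≤ G₁) (h₂ : H₂ ≤ G₂)
    (hd : Disjoint H₁ H₂) :
    Nat.card H₁ * Nat.card H₂ * Nat.card ↥(G₁ ⊓ G₂) ≤ Nat.card G₁ * Nat.card G₂ := by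
  have hA := card_mul_card_inf_le h₁ hd
  have hH : Nat.card ↥(H₂ ⊓ G₁) * G₁.relIndex H₂ = Nat.card H₂ := card_inf_mul_relIndex H₂ G₁
  have hG : Nat.card ↥(G₂ ⊓ G₁) * G₁.relIndex G₂ = Nat.card G₂ := card_inf_mul_relIndex G₂ G₁
  have hne : G₁.relIndex G₂ ≠ 0 := by
    rw [Subgroup.relIndex]
    exact Subgroup.index_ne_zero_of_finite
  have hr : G₁.relIndex H₂ ≤ G₁.relIndex G₂ := Subgroup.relIndex_le_of_le_right h₂ hne
  have hcomm : Nat.card ↥(G₁ ⊓ G₂) = Nat.card ↥(G₂ ⊓ G₁) := by rw [inf_comm]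
  calc Nat.card H₁ * Nat.card H₂ * Nat.card ↥(G₁ ⊓ G₂)
      = Nat.card H₁ * (Nat.card ↥(H₂ ⊓ G₁) * G₁.relIndex H₂) * Nat.card ↥(G₂ ⊓ G₁) := by
        rw [hH, hcomm]
    _ = (Nat.card H₁ * Nat.card ↥(H₂ ⊓ G₁)) * (Nat.card ↥(G₂ ⊓ G₁) * G₁.relIndex H₂) := by ring
    _ ≤ Nat.card G₁ * (Nat.card ↥(G₂ ⊓ G₁) * G₁.relIndex G₂) := by gcongr
    _ = Nat.card G₁ * Nat.card G₂ := by rw [hG]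

/-- Confinement for the pair `(H₁, H₂)` of a subgroup-TPP triple. -/
theorem confinement_tpp₁₂ [Finite G] {H₁ H₂ H₃ G₁ G₂ : Subgroup G} (htpp : SubgroupTPP H₁ H₂ H₃)
    (h₁ : H₁ ≤ G₁) (h₂ : H₂ ≤ G₂) :
    Nat.card H₁ * Nat.card H₂ * Nat.card ↥(G₁ ⊓ G₂) ≤ Nat.card G₁ * Nat.card G₂ := by
  refine confinement h₁ h₂ ?_
  rw [Subgroup.disjoint_def]
  intro x hx hx'
  exact (htpp x hx x⁻¹ (H₂.inv_mem hx') 1 H₃.one_mem (by simp)).1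

/-- Confinement for the pair `(H₁, H₃)` of a subgroup-TPP triple. -/
theorem confinement_tpp₁₃ [Finite G] {H₁ H₂ H₃ G₁ G₃ : Subgroup G} (htpp : SubgroupTPP H₁ H₂ H₃)
    (h₁ : H₁ ≤ G₁) (h₃ : H₃ ≤ G₃) :
    Nat.card H₁ * Nat.card H₃ * Nat.card ↥(G₁ ⊓ G₃) ≤ Nat.card G₁ * Nat.card G₃ := by
  refine confinement h₁ h₃ ?_
  rw [Subgroup.disjoint_def]
  intro x hx hx'
  exact (htpp x hx 1 H₂.one_mem x⁻¹ (H₃.inv_mem hx') (by simp)).1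

/-- Confinement for the pair `(H₂, H₃)` of a subgroup-TPP triple. -/
theorem confinement_tpp₂₃ [Finite G] {H₁ H₂ H₃ G₂ G₃ : Subgroup G} (htpp : SubgroupTPP H₁ H₂ H₃)
    (h₂ : H₂ ≤ G₂) (h₃ : H₃ ≤ G₃) :
    Nat.card H₂ * Nat.card H₃ * Nat.card ↥(G₂ ⊓ G₃) ≤ Nat.card G₂ * Nat.card G₃ := by
  refine confinement h₂ h₃ ?_
  rw [Subgroup.disjoint_def]
  intro x hx hx'
  exact (htpp 1 H₁.one_mem x hx x⁻¹ (H₃.inv_mem hx') (by simp)).2.1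

end BlockSliceConfinement

end Summit.MatrixMultiplication.MatrixMultiplication.Theorems.SubgroupIdentityDesigns.Negative
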